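import Literature.Probability.LatticeModels.FieldCurrentsTreeBound
import Literature.Probability.LatticeModels.GhostAvoidingCurrents
import HarnessLib

/-!
# The bound on the second-order weight `R` of Aizenman–Fernández's Thm. 5.7 via ghost-avoiding currents

Topic `Probability/LatticeModels`, namespace `Literature.Probability.LatticeModels`. Sequel of
`FieldCurrentsTreeBound` (Lemma 5.4 for general couplings, conditioning on `𝒮_b`, factorisation
with an inner functional) and `GhostAvoidingCurrents` (`G♭(u,k) = Z⁻¹∑_{∂n={u,k}} w 𝟙[u ↮ g]`,
`∑_k G♭(u,k) ≤ ⟨σ_u⟩/(βh)`).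

In the proof of Aizenman–Fernández 1986, Thm. 5.7 (pp. 438–441) the second-order term `S₂` is
controlled through the weights ((5.45) with `𝟙[{k,l} ∈ C(0)] ≤ 𝟙[0 ↔ k] + 𝟙[0 ↔ l]`)

  `R₂(0,x;u,k) = Z⁻² ∑_{∂n₁ = {0}Δ{x}, ∂n₂ = ∅} w w 𝟙[0 ↮ g] 𝟙[0 ↔ u] 𝟙[0 ↔ k]`.

The printed bound (5.49), `R ≤ [⟨σ₀σ_k⟩_{h=0} T(0,u,x) + (u ⇔ k)] + [k ⇔ l]`, does not follow
from Lemma 5.4 as claimed (conditioning on `C^c(h)` and (5.13) with `(x,u,y,l) := (0,u,x,k)`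
produce `T` with base point `k`, not `0`; pointwise (5.49) fails at `u = k`), and with base point
`k` the Schwarz step (5.51) produces the zero-field susceptibility. This file proves instead the
following bound, which suffices for the differential inequality (with the restricted ODE lemma of
`MagnetizationExponentUpperAFeR`): for `o, u, k ∈ Λ`, `β, h > 0`,

  `∑_{x ∈ Λ} R₂(o,x;u,k) ≤ ⟨σ_kσ_u⟩_{Λ;β,0} · [G♭(u,o) ⟨σ_k⟩/(βh) + G♭(o,k) ⟨σ_u⟩/(βh)]`
  (`sum_afR2_le`).

Route: decompose over the cluster of the ghost, `𝒮_g = S` (inside `S` the currents see no field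
and the connections of `o` stay inside `S`); factorise (`currentPairSum_clusterCompl_inner_mul_eq`);
switch `{o,u}` into the second current and apply **Lemma 5.4 in the system restricted to `S`**
(`af_treeBound` for `θ_S = θ𝟙_{ℰ_S}`):
`inner/Z_S² ≤ G_S(x,k)G_S(k,u)G_S(u,o) + G_S(o,k)G_S(k,u)G_S(u,x)`; bound the *link*
`G_S(k,u) ≤ ⟨σ_kσ_u⟩_{Λ,0}` (Griffiths, `θ_S ≤ θ⁰`); resum the remaining two factors with (5.1)
(`toReal_currentPairSum_pairs_clusterCompl_eq`) keeping the constraints `o, x ∈ S`, which become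
the ghost-avoidance indicators `𝟙[o ↮ g] 𝟙[x ↮ g]`; split them over the two currents
(`currentPairSum_le_gAvoidZ_mul`), `≤ G♭(x,k)G♭(u,o)` and `G♭(o,k)G♭(u,x)`; finally sum over `x`
with `∑_x G♭(k,x) ≤ ⟨σ_k⟩/(βh)`.

## References

* M. Aizenman, R. Fernández, J. Stat. Phys. **44** (1986) 393–454, §5.2, proof of Thm. 5.7,
  (5.43)–(5.51), pp. 438–441 [AizenmanFernandezJSP1986] (held: author copy `paper:url-b8cebc3f44bb`,
  PDF pp. 46–49).

## Mathlib

`ENNReal.tsum_mul_tsum`-type manipulations via `ENNReal.tsum_prod'`, `ENNReal.toReal_sum/mul`,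
`Finset.sum_le_sum`, `div_le_div_of_nonneg_right`.
-/

noncomputable section

open Finset MeasureTheory
open scoped symmDiff ENNReal

namespace Literature.Probability.LatticeModels

variable {V : Type*} [DecidableEq V]

section R2

variable {G : SimpleGraph V} [G.LocallyFinite] {Λ : Finset V}

local notation "Gg" => ghostGraph G Λ
local notation "Λg" => Finset.insertNone Λ
local notation "Eg" => edgesIn (ghostGraph G Λ) (Finset.insertNone Λ)
local notation "Zg[" θ ", " X "]" =>
  gcurrentZ (ghostGraph G Λ) (Finset.insertNone Λ) θ (edgesIn (ghostGraph G Λ) (Finset.insertNone Λ)) X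
local notation "Conn[" m ", " u ", " v "]" =>
  CConn (ghostGraph G Λ) (Finset.insertNone Λ) m (edgesIn (ghostGraph G Λ) (Finset.insertNone Λ)) u v
local notation "∂g" => csources (ghostGraph G Λ) (Finset.insertNone Λ)
local notation "𝒮[" m ", " b "]" => clusterCompl (ghostGraph G Λ) (Finset.insertNone Λ) m b

/-! ### Connections from a vertex of `𝒮_b` stay inside `𝒮_b` -/

/-- On `{𝒮_b(m) = S}`, a vertex `v ∈ S` is connected to `w` in `m` iff it is connected to `w`
through the restriction of `m` to the edges inside `S` (a path from `v` cannot leave `S`, whose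
outside is connected to `b`). [folklore] -/
theorem cconn_iff_cconn_crestr_of_clusterCompl_eq {m : Eg → ℕ} {b : Option V} {S : Finset (Option V)}
    (hS : 𝒮[m, b] = S) {v w : Option V} (hv : v ∈ S) :
    Conn[m, v, w] ↔ CConn Gg Λg (crestr Gg Λg (edgesIn Gg S) m) Eg v w := by
  refine ⟨fun h => ?_, fun h => h.mono fun e => crestr_le _ m e⟩
  -- invariant along the path: the current vertex is in `S` and reached inside `S`
  suffices hind : ∀ w, Conn[m, v, w] → w ∈ S ∧ CConn Gg Λg (crestr Gg Λg (edgesIn Gg S) m) Eg v w from (hind w h).2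
  intro w hw
  induction hw with
  | refl => exact ⟨hv, Relation.ReflTransGen.refl⟩
  | tail hac hcd ih =>
    rename_i c d'
    obtain ⟨hcS, hvc⟩ := ih
    obtain ⟨e, he, hpos, hes⟩ := hcd
    -- `d'` is in `S`: otherwise it is connected to `b`, hence so is `v`
    have hd : d' ∈ S := by
      by_contra hdS
      have hdΛ : d' ∈ Λg := (mem_edgesIn_iff.1 e.2).2 d' (by rw [hes]; exact Sym2.mem_mk_right c d')
      have hbd : Conn[m, b, d'] := by
        by_contra hnc
        exact hdS (hS ▸ mem_clusterCompl.2 ⟨hdΛ, hnc⟩)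
      have hvS : v ∈ 𝒮[m, b] := hS ▸ hv
      have hvd : Conn[m, v, d'] := hac.tail ⟨e, he, hpos, hes⟩
      have hbv : Conn[m, b, v] := hbd.trans hvd.symm
      exact (mem_clusterCompl.1 hvS).2 hbv
    refine ⟨hd, hvc.tail ⟨e, he, ?_, hes⟩⟩
    have heS : (e : Sym2 (Option V)) ∈ edgesIn Gg S := by
      rw [mem_edgesIn_iff]
      refine ⟨(mem_edgesIn_iff.1 e.2).1, fun t ht => ?_⟩
      rw [hes] at ht
      rcases Sym2.mem_iff.1 ht with rfl | rfl
      · exact hcS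
      · exact hd
    rwa [crestr_apply_of_mem m heS]

/-! ### Splitting a pair sum over the two currents -/

/-- **A pair sum with a functional dominated by a product splits**: if
`F(n₁ + n₂) ≤ F₁(n₁) F₂(n₂)` whenever `∂n₁ = X`, `∂n₂ = Y`, then
`∑_{X,Y} w w F ≤ (∑_{∂n = X} w F₁) (∑_{∂n = Y} w F₂)`. [folklore] -/
theorem currentPairSum_le_mul_of_le {θ : Sym2 (Option V) → ℝ} {X Y : Finset (Option V)} {F F₁ F₂ : (Eg → ℕ) → ℝ≥0∞}
    (h : ∀ n₁ n₂, ∂g n₁ = X → ∂g n₂ = Y → F (n₁ + n₂) ≤ F₁ n₁ * F₂ n₂) :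
    currentPairSum G Λ θ X Y F ≤
      (∑' n : Eg → ℕ, ind (∂g n = X) * (gweight Gg Λg θ n * F₁ n)) *
        ∑' n : Eg → ℕ, ind (∂g n = Y) * (gweight Gg Λg θ n * F₂ n) := by
  unfold currentPairSum
  rw [tsum_mul_tsum_eq_tsum_prod, ENNReal.tsum_prod', ENNReal.tsum_prod']
  refine ENNReal.tsum_le_tsum fun n₁ => ENNReal.tsum_le_tsum fun n₂ => ?_
  dsimp only
  by_cases h1 : ∂g n₁ = X
  · by_cases h2 : ∂g n₂ = Y
    · rw [ind_of_true ⟨h1, csupp_edgesIn _⟩, ind_of_true ⟨h2, csupp_edgesIn _⟩, ind_of_true h1, ind_of_true h2]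
      have := h n₁ n₂ h1 h2
      calc (1 : ℝ≥0∞) * 1 * (gweight Gg Λg θ n₁ * gweight Gg Λg θ n₂ * F (n₁ + n₂))
          ≤ 1 * 1 * (gweight Gg Λg θ n₁ * gweight Gg Λg θ n₂ * (F₁ n₁ * F₂ n₂)) := by gcongr
        _ = 1 * (gweight Gg Λg θ n₁ * F₁ n₁) * (1 * (gweight Gg Λg θ n₂ * F₂ n₂)) := by ring
    · rw [ind_of_false (show ¬(∂g n₂ = Y ∧ CSupp Gg Λg Eg n₂) from fun h' => h2 h'.1), ind_of_false h2]; simp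
  · rw [ind_of_false (show ¬(∂g n₁ = X ∧ CSupp Gg Λg Eg n₁) from fun h' => h1 h'.1), ind_of_false h1]; simp

/-- **The disconnected two-pair weight is at most a product of ghost-avoiding sums**:
`∑_{({a}Δ{c})*, ({p}Δ{q})*} w w 𝟙[a ↮ g] 𝟙[p ↮ g] ≤ (Z G♭(a,c)) (Z G♭(p,q))` (ghost-avoidance in
`n₁ + n₂` implies ghost-avoidance in each current). [folklore] -/
theorem currentPairSum_notConn_notConn_le_gAvoidZ_mul (θ : Sym2 (Option V) → ℝ) (a c p q : V) :
    currentPairSum G Λ θ ({some a} ∆ {some c}) ({some p} ∆ {some q})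
        (fun m => ind (¬Conn[m, some a, none]) * ind (¬Conn[m, some p, none])) ≤
      gAvoidZ G Λ θ a c * gAvoidZ G Λ θ p q := by
  unfold gAvoidZ
  have hrew : ∀ (Z : Finset (Option V)) (v : V),
      (∑' n : Eg → ℕ, ind (∂g n = Z ∧ ¬Conn[n, some v, none]) * gweight Gg Λg θ n) =
        ∑' n : Eg → ℕ, ind (∂g n = Z) * (gweight Gg Λg θ n * ind (¬Conn[n, some v, none])) := by
    intro Z v
    refine tsum_congr fun n => ?_
    rw [ind_and]; ring
  rw [hrew, hrew]
  refine currentPairSum_le_mul_of_le fun n₁ n₂ _ _ => ?_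
  by_cases h1 : Conn[n₁, some a, none]
  · have h1' : Conn[n₁ + n₂, some a, none] := CConn.mono (fun e => Nat.le_add_right _ _) h1
    rw [ind_of_false (not_not.2 h1'), zero_mul]; exact bot_le
  by_cases h2 : Conn[n₂, some p, none]
  · have h2' : Conn[n₁ + n₂, some p, none] := CConn.mono (fun e => Nat.le_add_left _ _) h2
    rw [mul_comm, ind_of_false (not_not.2 h2'), zero_mul]; exact bot_le
  rw [ind_of_true h1, ind_of_true h2]
  exact mul_le_mul' (ind_le_one _) (ind_le_one _)

/-- The symmetric variant: `∑_{({a}Δ{c})*, ({p}Δ{q})*} w w 𝟙[a ↮ g] 𝟙[q ↮ g] ≤ (Z G♭(a,c)) (Z G♭(p,q))`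
(`q ↮ g` in `n₁+n₂` and `p ↔ q` in `n₂` give `p ↮ g` in `n₂`). [folklore] -/
theorem currentPairSum_notConn_notConn_le_gAvoidZ_mul' (θ : Sym2 (Option V) → ℝ) (a c p q : V) :
    currentPairSum G Λ θ ({some a} ∆ {some c}) ({some p} ∆ {some q})
        (fun m => ind (¬Conn[m, some a, none]) * ind (¬Conn[m, some q, none])) ≤
      gAvoidZ G Λ θ a c * gAvoidZ G Λ θ p q := by
  unfold gAvoidZ
  have hrew : ∀ (Z : Finset (Option V)) (v : V),
      (∑' n : Eg → ℕ, ind (∂g n = Z ∧ ¬Conn[n, some v, none]) * gweight Gg Λg θ n) =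
        ∑' n : Eg → ℕ, ind (∂g n = Z) * (gweight Gg Λg θ n * ind (¬Conn[n, some v, none])) := by
    intro Z v
    refine tsum_congr fun n => ?_
    rw [ind_and]; ring
  rw [hrew, hrew]
  refine currentPairSum_le_mul_of_le fun n₁ n₂ _ h2src => ?_
  by_cases h1 : Conn[n₁, some a, none]
  · have h1' : Conn[n₁ + n₂, some a, none] := CConn.mono (fun e => Nat.le_add_right _ _) h1
    rw [ind_of_false (not_not.2 h1'), zero_mul]; exact bot_le
  by_cases h2 : Conn[n₂, some p, none]
  · have hpq : Conn[n₂, some p, some q] := by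
      by_cases hpq : p = q
      · subst hpq; exact Relation.ReflTransGen.refl
      · exact cconn_of_csources_eq (fun h => hpq (Option.some_injective _ h)) h2src
    have hq : Conn[n₁ + n₂, some q, none] := CConn.mono (fun e => Nat.le_add_left _ _) (hpq.symm.trans h2)
    rw [mul_comm, ind_of_false (not_not.2 hq), zero_mul]; exact bot_le
  rw [ind_of_true h1, ind_of_true h2]
  exact mul_le_mul' (ind_le_one _) (ind_le_one _)

/-! ### Griffiths II for couplings compared on the edges of the ghost graph only -/

/-- **GKS II with couplings compared on `ℰ⁺_Λ`**: `0 ≤ θ`, `θ ≤ θ'` on the edges of the ghost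
graph inside `Λ ∪ {g}` give `⟨σ_A⟩_θ ≤ ⟨σ_A⟩_{θ'}` (the state only reads the couplings there). [cite: FriedliVelenik2017, Exercise 3.31, p. 142] -/
theorem thetaCorr_mono_of_le_on {θ θ' : Sym2 (Option V) → ℝ} (hθ : ∀ e, 0 ≤ θ e) (hle : ∀ e ∈ Eg, θ e ≤ θ' e)
    {A : Finset V} (hA : A ⊆ Λ) : thetaCorr G Λ θ A ≤ thetaCorr G Λ θ' A := by
  rw [thetaCorr_eq_gksExpect hA, thetaCorr_eq_gksExpect hA]
  refine gksExpect_mono_of_abs_le _ _ (fun i hi => ?_) _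
  rcases i with e | x
  · simp only [thetaCpl]
    split_ifs with he
    · rw [abs_of_nonneg (hθ _)]
      exact hle _ (map_liftEdge_subset_edgesIn (G := G) (Λ := Λ) subset_rfl (mem_map_of_mem _ he))
    · simp
  · simp only [thetaCpl]
    rw [abs_of_nonneg (hθ _)]
    have hx : x ∈ Λ := by
      unfold isingIdx at hi; exact Finset.inr_mem_disjSum.1 hi
    exact hle _ (ghostEdge_mem_edgesIn hx)

/-- **The link of the restricted system is dominated by the zero-field link**: for `S ⊆ Λ ∪ {g}`
not containing the ghost, `⟨σ_kσ_u⟩_{θ_S} ≤ ⟨σ_kσ_u⟩_{θ, h=0}` (the restricted system has no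
field and fewer bonds; Aizenman–Fernández's `⟨σ₀σ_k⟩_{C^c(h)} ≤ ⟨σ₀σ_k⟩_{h=0}`, p. 440). [cite: AizenmanFernandezJSP1986, §5.2, proof of Thm. 5.7, p. 440] -/
theorem thetaCorr_cplOff_le_zeroField {θ : Sym2 (Option V) → ℝ} (hθ : ∀ e, 0 ≤ θ e) {S : Finset (Option V)}
    (hn : (none : Option V) ∉ S) {A : Finset V} (hA : A ⊆ Λ) :
    thetaCorr G Λ (cplOff θ (Eg \ edgesIn Gg S)) A ≤ thetaCorr G Λ (zeroField θ) A := by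
  refine thetaCorr_mono_of_le_on (cplOff_nonneg hθ _) (fun e he => ?_) hA
  unfold cplOff zeroField
  by_cases hg : (none : Option V) ∈ e
  · rw [if_pos hg]
    have : e ∈ Eg \ edgesIn Gg S := mem_sdiff.2 ⟨he, fun h => hn ((mem_edgesIn_iff.1 h).2 none hg)⟩
    rw [if_pos this]
  · rw [if_neg hg]
    split_ifs
    · exact hθ e
    · exact le_rfl

/-! ### (5.1) for two pairs whose first vertices lie in `T` -/

/-- (5.1) for two pairs of sources, given only that the first vertex of each pair lifts into `T`
(the other cases vanish on both sides). [cite: AizenmanFernandezJSP1986, §5.1, Lemma 5.1, eq. (5.1), p. 425] -/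
theorem toReal_currentPairSum_pairs_clusterCompl_eq' {θ : Sym2 (Option V) → ℝ} (hθ : ∀ e, 0 ≤ θ e)
    {T : Finset (Option V)} (hT : T ⊆ Λg) {b : Option V} (hb : b ∈ Λg \ T) {a c a' c' : V}
    (ha : a ∈ Λ) (hc : c ∈ Λ) (ha' : a' ∈ Λ) (hc' : c' ∈ Λ)
    (haT : (some a : Option V) ∈ T) (ha'T : (some a' : Option V) ∈ T) :
    (currentPairSum G Λ θ ({some a} ∆ {some c}) ({some a'} ∆ {some c'}) (fun m => ind (𝒮[m, b] = T))).toReal =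
      thetaCorr G Λ (cplOff θ (Eg \ edgesIn Gg T)) ({a} ∆ {c}) *
        thetaCorr G Λ (cplOff θ (Eg \ edgesIn Gg T)) ({a'} ∆ {c'}) * (dctWb G Λ θ b T).toReal := by
  by_cases hcT : (some c : Option V) ∈ T
  swap
  · have hac : a ≠ c := fun h => hcT (h ▸ haT)
    rw [show (fun m => ind (𝒮[m, b] = T)) = (fun m : Eg → ℕ => ind (𝒮[m, b] = T) * 1) from
        funext fun _ => (mul_one _).symm,
      currentPairSum_clusterCompl_eq_zero_left θ haT hcT hc, thetaCorr_cplOff_pair_eq_zero hθ hT ha hc hac (Or.inr hcT)]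
    simp
  by_cases hc'T : (some c' : Option V) ∈ T
  swap
  · have hac' : a' ≠ c' := fun h => hc'T (h ▸ ha'T)
    rw [show (fun m => ind (𝒮[m, b] = T)) = (fun m : Eg → ℕ => ind (𝒮[m, b] = T) * 1) from
        funext fun _ => (mul_one _).symm,
      currentPairSum_clusterCompl_eq_zero_right θ ha'T hc'T hc', thetaCorr_cplOff_pair_eq_zero hθ hT ha' hc' hac' (Or.inr hc'T)]
    simp
  exact toReal_currentPairSum_pairs_clusterCompl_eq hθ hT hb ha hc ha' hc' haT hcT ha'T hc'T

/-! ### The bound for a fixed cluster of the ghost -/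

/-- **The second-order weight on `{𝒮_g = S}`, bounded by the tree bound inside `S`**: for
`θ ≥ 0`, `o, x, u, k ∈ Λ`, and `S ⊆ Λ ∪ {g}` with `g ∉ S`, `o, x ∈ S`,
`∑_{({o}Δ{x})*, ∅} w w 𝟙[𝒮_g = S] 𝟙[o ↔ u] 𝟙[o ↔ k]`
` ≤ ⟨σ_kσ_u⟩_{θ,h=0} · (∑_{({x}Δ{k})*,({u}Δ{o})*} w w 𝟙[𝒮_g = S] + ∑_{({o}Δ{k})*,({x}Δ{u})*} w w 𝟙[𝒮_g = S])`
(factorise on `{𝒮_g = S}`, switch `{o,u}` into the second current inside `S`, Lemma 5.4 for the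
restricted system, `G_S(k,u) ≤ ⟨σ_kσ_u⟩_{h=0}`, and (5.1) backwards). This replaces the step
(5.49) of the printed proof. [cite: AizenmanFernandezJSP1986, §5.2, proof of Thm. 5.7, (5.45)–(5.49), pp. 438–440] -/
theorem afR2_clusterCompl_le {θ : Sym2 (Option V) → ℝ} (hθ : ∀ e, 0 ≤ θ e) {o x u k : V} (ho : o ∈ Λ)
    (hx : x ∈ Λ) (hu : u ∈ Λ) (hk : k ∈ Λ) {S : Finset (Option V)} (hS : S ⊆ Λg) (hn : (none : Option V) ∉ S)
    (hoS : (some o : Option V) ∈ S) (hxS : (some x : Option V) ∈ S) :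
    (currentPairSum G Λ θ ({some o} ∆ {some x}) ∅
        (fun m => ind (𝒮[m, none] = S) * (ind (Conn[m, some o, some u]) * ind (Conn[m, some o, some k])))).toReal ≤
      thetaCorr G Λ (zeroField θ) ({k} ∆ {u}) *
        ((currentPairSum G Λ θ ({some x} ∆ {some k}) ({some u} ∆ {some o}) (fun m => ind (𝒮[m, none] = S))).toReal +
          (currentPairSum G Λ θ ({some o} ∆ {some k}) ({some x} ∆ {some u}) (fun m => ind (𝒮[m, none] = S))).toReal) := by
  set E₁ := edgesIn Gg S with hE₁
  set θS := cplOff θ (Eg \ E₁) with hθSdef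
  have hθS : ∀ e, 0 ≤ θS e := cplOff_nonneg hθ _
  have hb : (none : Option V) ∈ Λg \ S := mem_sdiff.2 ⟨Finset.mem_insertNone.2 (by simp), hn⟩
  set X : Finset (Option V) := {some o} ∆ {some x} with hX
  have hXS : X ⊆ S := symmDiff_le_sup.trans (sup_le (singleton_subset_iff.2 hoS) (singleton_subset_iff.2 hxS))
  -- Step 1: replace the connections by connections of the restricted current
  set F' : (Eg → ℕ) → ℝ≥0∞ := fun m =>
    ind (CConn Gg Λg (crestr Gg Λg E₁ m) Eg (some o) (some u)) * ind (CConn Gg Λg (crestr Gg Λg E₁ m) Eg (some o) (some k))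
    with hF'
  have hstep1 : currentPairSum G Λ θ X ∅
      (fun m => ind (𝒮[m, none] = S) * (ind (Conn[m, some o, some u]) * ind (Conn[m, some o, some k]))) =
      currentPairSum G Λ θ X ∅ (fun m => ind (𝒮[m, none] = S) * F' m) := by
    refine currentPairSum_congr fun n₁ n₂ _ _ => ?_
    by_cases hSm : 𝒮[n₁ + n₂, none] = S
    · rw [ind_of_true hSm, one_mul, one_mul]
      simp only [hF']
      rw [ind_congr (cconn_iff_cconn_crestr_of_clusterCompl_eq hSm hoS),
        ind_congr (cconn_iff_cconn_crestr_of_clusterCompl_eq hSm hoS)]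
    · rw [ind_of_false hSm, zero_mul, zero_mul]
  have hF'r : ∀ m, F' m = F' (crestr Gg Λg E₁ m) := fun m => by
    simp only [hF', crestr_eq_self_of_csupp (csupp_crestr E₁ m)]
  -- Step 2: factorise
  have hfac := currentPairSum_clusterCompl_inner_mul_eq θ hS hb hXS (empty_subset S) hF'r
  -- Step 3: in the restricted system, `F'` is the plain event
  have hstep3 : currentPairSum G Λ θS X ∅ F' =
      currentPairSum G Λ θS X ∅ (fun m => ind (Conn[m, some o, some k]) * ind (Conn[m, some o, some u])) := by
    simp only [hθSdef]
    rw [currentPairSum_cplOff, currentPairSum_cplOff, Finset.sdiff_sdiff_eq_self (edgesIn_mono Gg hS)]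
    refine currentPairSum_congr fun n₁ n₂ _ _ => ?_
    by_cases hsupp : CSupp Gg Λg E₁ (n₁ + n₂)
    · rw [ind_of_true hsupp, one_mul, one_mul]
      simp only [hF', crestr_eq_self_of_csupp hsupp]
      ring
    · rw [ind_of_false hsupp, zero_mul, zero_mul]
  -- Step 4: switch `{o,u}` into the second current and rename the event
  have hstep4 : currentPairSum G Λ θS X ∅ (fun m => ind (Conn[m, some o, some k]) * ind (Conn[m, some o, some u])) =
      currentPairSum G Λ θS ({some x} ∆ {some u}) ({some u} ∆ {some o}) (fun m => ind (Conn[m, some x, some k])) := by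
    rw [← currentPairSum_switching hθS X (some o) (some u) (fun m => ind (Conn[m, some o, some k])), hX,
      pair_symmDiff_pair_left, symmDiff_comm {some o} {some u}]
    refine currentPairSum_congr fun n₁ n₂ h1 h2 => ind_congr ?_
    -- on these sources `x ↔ u ↔ o`
    have hxu : Conn[n₁ + n₂, some x, some u] := by
      by_cases e : x = u
      · subst e; exact Relation.ReflTransGen.refl
      · exact CConn.mono (fun e => Nat.le_add_right _ _) (cconn_of_csources_eq (fun h => e (Option.some_injective _ h)) h1)
    have huo : Conn[n₁ + n₂, some u, some o] := by
      by_cases e : u = o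
      · subst e; exact Relation.ReflTransGen.refl
      · exact CConn.mono (fun e => Nat.le_add_left _ _) (cconn_of_csources_eq (fun h => e (Option.some_injective _ h)) h2)
    have hxo : Conn[n₁ + n₂, some x, some o] := hxu.trans huo
    exact ⟨fun h => hxo.trans h, fun h => hxo.symm.trans h⟩
  -- Step 5: Lemma 5.4 in the restricted system
  have htree := af_treeBound (G := G) (Λ := Λ) hθS hx hu ho hk
  have hZS : Zg[θS, ∅] = gcurrentZ Gg Λg θ E₁ ∅ := by
    simp only [hθSdef]; rw [gcurrentZ_cplOff, Finset.sdiff_sdiff_eq_self (edgesIn_mono Gg hS)]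
  rw [hZS] at htree
  have hZpos : 0 < (gcurrentZ Gg Λg θ E₁ ∅).toReal := toReal_gcurrentZ_inner_empty_pos hθ hS
  -- Step 6: assemble in real numbers
  have hfacR := congrArg ENNReal.toReal hfac
  rw [ENNReal.toReal_mul, ENNReal.toReal_mul, ENNReal.toReal_mul, hstep3, hstep4] at hfacR
  rw [hstep1]
  set PSin := (currentPairSum G Λ θS ({some x} ∆ {some u}) ({some u} ∆ {some o})
    (fun m => ind (Conn[m, some x, some k]))).toReal with hPSin
  set W := (dctWb G Λ θ none S).toReal with hW
  have hW0 : 0 ≤ W := ENNReal.toReal_nonneg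
  set ZS := (gcurrentZ Gg Λg θ E₁ ∅).toReal with hZSdef
  -- `lhs = PSin / ZS² · W`
  have hlhs : (currentPairSum G Λ θ X ∅ (fun m => ind (𝒮[m, none] = S) * F' m)).toReal = PSin / ZS ^ 2 * W := by
    field_simp
    linear_combination hfacR
  rw [hlhs]
  -- the tree bound and the link bound
  set GS : V → V → ℝ := fun a c => thetaCorr G Λ θS ({a} ∆ {c}) with hGS
  have hGS0 : ∀ a c, a ∈ Λ → c ∈ Λ → 0 ≤ GS a c := fun a c ha hc =>
    thetaCorr_nonneg hθS (symmDiff_le_sup.trans (sup_le (singleton_subset_iff.2 ha) (singleton_subset_iff.2 hc)))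
  have hlink : GS k u ≤ thetaCorr G Λ (zeroField θ) ({k} ∆ {u}) :=
    thetaCorr_cplOff_le_zeroField hθ hn (symmDiff_le_sup.trans (sup_le (singleton_subset_iff.2 hk) (singleton_subset_iff.2 hu)))
  have hL0 : 0 ≤ thetaCorr G Λ (zeroField θ) ({k} ∆ {u}) := le_trans (hGS0 k u hk hu) hlink
  have htree' : PSin / ZS ^ 2 ≤ GS x k * GS k u * GS u o + GS o k * GS k u * GS u x := htree
  -- (5.1) backwards for the two remaining pairs
  have hpair1 : (currentPairSum G Λ θ ({some x} ∆ {some k}) ({some u} ∆ {some o}) (fun m => ind (𝒮[m, none] = S))).toReal =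
      GS x k * GS u o * W :=
    by rw [symmDiff_comm ({some u} : Finset (Option V)) {some o},
      toReal_currentPairSum_pairs_clusterCompl_eq' hθ hS hb hx hk ho hu hxS hoS, symmDiff_comm ({o} : Finset V) {u}]
  have hpair2 : (currentPairSum G Λ θ ({some o} ∆ {some k}) ({some x} ∆ {some u}) (fun m => ind (𝒮[m, none] = S))).toReal =
      GS o k * GS x u * W :=
    toReal_currentPairSum_pairs_clusterCompl_eq' hθ hS hb ho hk hx hu hoS hxS
  rw [hpair1, hpair2]
  have hGsymm : GS u x = GS x u := by simp only [hGS, symmDiff_comm]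
  rw [hGsymm] at htree'
  calc PSin / ZS ^ 2 * W ≤ (GS x k * GS k u * GS u o + GS o k * GS k u * GS x u) * W :=
        mul_le_mul_of_nonneg_right htree' hW0
    _ ≤ (GS x k * thetaCorr G Λ (zeroField θ) ({k} ∆ {u}) * GS u o +
          GS o k * thetaCorr G Λ (zeroField θ) ({k} ∆ {u}) * GS x u) * W := by
        refine mul_le_mul_of_nonneg_right (add_le_add ?_ ?_) hW0
        · exact mul_le_mul_of_nonneg_right (mul_le_mul_of_nonneg_left hlink (hGS0 x k hx hk)) (hGS0 u o hu ho)
        · exact mul_le_mul_of_nonneg_right (mul_le_mul_of_nonneg_left hlink (hGS0 o k ho hk)) (hGS0 x u hx hu)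
    _ = _ := by ring

/-! ### Summing over the clusters and over `x` -/

/-- **The second-order weight bounded by ghost-avoiding sums** (general `θ ≥ 0`): for
`o, x, u, k ∈ Λ`,
`∑_{({o}Δ{x})*,∅} w w 𝟙[o ↮ g] 𝟙[o ↔ u] 𝟙[o ↔ k] ≤ ⟨σ_kσ_u⟩_{θ,h=0} (Z²G♭(x,k)G♭(u,o) + Z²G♭(o,k)G♭(x,u))`. [cite: AizenmanFernandezJSP1986, §5.2, proof of Thm. 5.7, (5.45)–(5.51), pp. 438–441] -/
theorem afR2_le {θ : Sym2 (Option V) → ℝ} (hθ : ∀ e, 0 ≤ θ e) {o x u k : V} (ho : o ∈ Λ) (hx : x ∈ Λ)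
    (hu : u ∈ Λ) (hk : k ∈ Λ) :
    (currentPairSum G Λ θ ({some o} ∆ {some x}) ∅
        (fun m => ind (¬Conn[m, some o, none]) * (ind (Conn[m, some o, some u]) * ind (Conn[m, some o, some k])))).toReal ≤
      thetaCorr G Λ (zeroField θ) ({k} ∆ {u}) *
        ((gAvoidZ G Λ θ x k * gAvoidZ G Λ θ u o).toReal + (gAvoidZ G Λ θ o k * gAvoidZ G Λ θ x u).toReal) := by
  classical
  set P := Λ.powerset.filter (fun S' => o ∈ S' ∧ x ∈ S') with hP
  set F : (Eg → ℕ) → ℝ≥0∞ := fun m => ind (Conn[m, some o, some u]) * ind (Conn[m, some o, some k]) with hF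
  have hF1 : ∀ m, F m ≤ 1 := fun m => by
    refine le_trans (mul_le_mul' (ind_le_one _) (ind_le_one _)) ?_; rw [one_mul]
  -- decomposition over the real part `S'` of `𝒮_g`, with `o, x ∈ S'`
  have hdec : currentPairSum G Λ θ ({some o} ∆ {some x}) ∅ (fun m => ind (¬Conn[m, some o, none]) * F m) =
      ∑ S' ∈ P, currentPairSum G Λ θ ({some o} ∆ {some x}) ∅
        (fun m => ind (𝒮[m, none] = S'.map Function.Embedding.some) * F m) := by
    rw [← currentPairSum_finset_sum]
    refine currentPairSum_congr fun n₁ n₂ h1 _ => ?_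
    rw [← sum_mul, sum_ind_clusterCompl_none, mem_eraseNone_clusterCompl_none_iff ho,
      mem_eraseNone_clusterCompl_none_iff hx]
    -- `x ↮ g` is automatic given `o ↮ g` and `o ↔ x`
    refine congrArg (· * F (n₁ + n₂)) (ind_congr ⟨fun h => ⟨h, fun hxg => h ?_⟩, fun h => h.1⟩)
    by_cases hox : o = x
    · subst hox; exact hxg
    · exact (CConn.mono (fun e => Nat.le_add_right _ _)
        (cconn_of_csources_eq (fun h' => hox (Option.some_injective _ h')) h1)).trans hxg
  have hsumind : ∀ (X' Y' : Finset (Option V)),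
      ∑ S' ∈ P, currentPairSum G Λ θ X' Y' (fun m => ind (𝒮[m, none] = S'.map Function.Embedding.some)) =
        currentPairSum G Λ θ X' Y' (fun m => ind (¬Conn[m, some o, none]) * ind (¬Conn[m, some x, none])) := by
    intro X' Y'
    rw [← currentPairSum_finset_sum]
    refine currentPairSum_congr fun n₁ n₂ _ _ => ?_
    rw [sum_ind_clusterCompl_none, mem_eraseNone_clusterCompl_none_iff ho, mem_eraseNone_clusterCompl_none_iff hx, ind_and]
  -- termwise bound
  have hterm : ∀ S' ∈ P, (currentPairSum G Λ θ ({some o} ∆ {some x}) ∅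
      (fun m => ind (𝒮[m, none] = S'.map Function.Embedding.some) * F m)).toReal ≤
      thetaCorr G Λ (zeroField θ) ({k} ∆ {u}) *
        ((currentPairSum G Λ θ ({some x} ∆ {some k}) ({some u} ∆ {some o})
            (fun m => ind (𝒮[m, none] = S'.map Function.Embedding.some))).toReal +
          (currentPairSum G Λ θ ({some o} ∆ {some k}) ({some x} ∆ {some u})
            (fun m => ind (𝒮[m, none] = S'.map Function.Embedding.some))).toReal) := by
    intro S' hS'
    obtain ⟨hS'Λ, hoS', hxS'⟩ := mem_filter.1 hS'
    have hSΛ : S'.map Function.Embedding.some ⊆ Λg := fun v hv => by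
      obtain ⟨t, ht, rfl⟩ := mem_map.1 hv
      exact Finset.some_mem_insertNone.2 (mem_powerset.1 hS'Λ ht)
    have hn : (none : Option V) ∉ S'.map Function.Embedding.some := fun h => by
      obtain ⟨t, -, ht⟩ := mem_map.1 h; exact Option.some_ne_none t ht
    exact afR2_clusterCompl_le hθ ho hx hu hk hSΛ hn (mem_map_of_mem _ hoS') (mem_map_of_mem _ hxS')
  rw [hdec, ENNReal.toReal_sum (fun S' _ => currentPairSum_ne_top hθ _ _ fun m =>
    le_trans (mul_le_mul' (ind_le_one _) (hF1 m)) (by rw [one_mul]))]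
  refine (sum_le_sum hterm).trans ?_
  rw [← mul_sum, sum_add_distrib,
    ← ENNReal.toReal_sum (fun S' _ => currentPairSum_ne_top hθ _ _ fun _ => ind_le_one _),
    ← ENNReal.toReal_sum (fun S' _ => currentPairSum_ne_top hθ _ _ fun _ => ind_le_one _), hsumind, hsumind]
  have hL0 : 0 ≤ thetaCorr G Λ (zeroField θ) ({k} ∆ {u}) :=
    thetaCorr_nonneg (zeroField_nonneg hθ) (symmDiff_le_sup.trans (sup_le (singleton_subset_iff.2 hk) (singleton_subset_iff.2 hu)))
  refine mul_le_mul_of_nonneg_left (add_le_add ?_ ?_) hL0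
  · refine ENNReal.toReal_mono (ENNReal.mul_ne_top (gAvoidZ_ne_top hθ _ _) (gAvoidZ_ne_top hθ _ _)) ?_
    refine le_trans (le_of_eq ?_) (currentPairSum_notConn_notConn_le_gAvoidZ_mul' θ x k u o)
    exact currentPairSum_congr fun _ _ _ _ => mul_comm _ _
  · refine ENNReal.toReal_mono (ENNReal.mul_ne_top (gAvoidZ_ne_top hθ _ _) (gAvoidZ_ne_top hθ _ _)) ?_
    exact currentPairSum_notConn_notConn_le_gAvoidZ_mul θ o k x u

/-- `G♭` is symmetric: `∑_{∂n = {u,k}} w 𝟙[u ↮ g] = ∑_{∂n = {k,u}} w 𝟙[k ↮ g]` (on these sources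
`u ↔ k`). [folklore] -/
theorem gAvoidZ_comm (θ : Sym2 (Option V) → ℝ) (u k : V) : gAvoidZ G Λ θ u k = gAvoidZ G Λ θ k u := by
  unfold gAvoidZ
  refine tsum_congr fun n => ?_
  congr 1
  refine ind_congr ?_
  rw [symmDiff_comm ({some k} : Finset (Option V)) {some u}]
  constructor
  · rintro ⟨hsrc, hnc⟩
    refine ⟨hsrc, fun hk => hnc ?_⟩
    by_cases huk : u = k
    · subst huk; exact hk
    · exact (cconn_of_csources_eq (fun h => huk (Option.some_injective _ h)) hsrc).trans hk
  · rintro ⟨hsrc, hnc⟩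
    refine ⟨hsrc, fun hu => hnc ?_⟩
    by_cases huk : u = k
    · subst huk; exact hu
    · exact (cconn_of_csources_eq (fun h => huk (Option.some_injective _ h)) hsrc).symm.trans hu

/-- The zero-field couplings of the uniform system. [folklore] -/
theorem zeroField_ghostCoupling (β k : ℝ) : zeroField (ghostCoupling β k) = ghostCoupling (V := V) β (β * 0) := by
  funext e
  unfold zeroField ghostCoupling
  rw [mul_zero]
  split_ifs <;> rfl

/-- **The summed second-order weight of Aizenman–Fernández's Thm. 5.7, bounded with
ghost-avoiding currents** (replacing (5.49)–(5.51)): for the free Ising state with `β, h > 0` and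
`o, u, k ∈ Λ`,
`∑_{x∈Λ} R₂(o,x;u,k) ≤ ⟨σ_kσ_u⟩_{Λ;β,0} · [G♭(u,o) ⟨σ_k⟩/(βh) + G♭(o,k) ⟨σ_u⟩/(βh)]`, where
`R₂(o,x;u,k) = Z⁻² ∑_{({o}Δ{x})*,∅} w w 𝟙[o ↮ g] 𝟙[o ↔ u] 𝟙[o ↔ k]` and `G♭(a,c) = Z⁻¹∑_{∂n=({a}Δ{c})*} w 𝟙[a ↮ g]`. [cite: AizenmanFernandezJSP1986, §5.2, proof of Thm. 5.7, (5.45)–(5.51), pp. 438–441] -/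
theorem sum_afR2_le {β h : ℝ} (hβ : 0 < β) (hh : 0 < h) {o u k : V} (ho : o ∈ Λ) (hu : u ∈ Λ) (hk : k ∈ Λ) :
    ∑ x ∈ Λ, (currentPairSum G Λ (ghostCoupling β (β * h)) ({some o} ∆ {some x}) ∅
        (fun m => ind (¬Conn[m, some o, none]) * (ind (Conn[m, some o, some u]) * ind (Conn[m, some o, some k])))).toReal /
          (Zg[ghostCoupling β (β * h), ∅]).toReal ^ 2 ≤
      isingCorr G Λ β 0 .free ({k} ∆ {u}) *
        ((gAvoidZ G Λ (ghostCoupling β (β * h)) u o).toReal / (Zg[ghostCoupling β (β * h), ∅]).toReal *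
            (isingCorr G Λ β h .free {k} / (β * h)) +
          (gAvoidZ G Λ (ghostCoupling β (β * h)) o k).toReal / (Zg[ghostCoupling β (β * h), ∅]).toReal *
            (isingCorr G Λ β h .free {u} / (β * h))) := by
  set θ : Sym2 (Option V) → ℝ := ghostCoupling β (β * h) with hθdef
  have hθ : ∀ e, 0 ≤ θ e := fun e => ghostCoupling_nonneg hβ.le (mul_nonneg hβ.le hh.le) e
  set Z : ℝ := (Zg[θ, ∅]).toReal with hZ
  have hZpos : 0 < Z := toReal_gcurrentZ_ghost_empty_pos subset_rfl hθ subset_rfl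
  set L : ℝ := isingCorr G Λ β 0 .free ({k} ∆ {u}) with hL
  have hLθ : thetaCorr G Λ (zeroField θ) ({k} ∆ {u}) = L := by
    rw [hθdef, zeroField_ghostCoupling, thetaCorr_ghostCoupling]
  have hL0 : 0 ≤ L := by
    rw [← hLθ]
    exact thetaCorr_nonneg (G := G) (Λ := Λ) (zeroField_nonneg hθ)
      (symmDiff_le_sup.trans (sup_le (singleton_subset_iff.2 hk) (singleton_subset_iff.2 hu)))
  set A : V → V → ℝ := fun a c => (gAvoidZ G Λ θ a c).toReal with hA
  have hA0 : ∀ a c, 0 ≤ A a c := fun a c => ENNReal.toReal_nonneg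
  -- termwise
  have hterm : ∀ x ∈ Λ, (currentPairSum G Λ θ ({some o} ∆ {some x}) ∅
      (fun m => ind (¬Conn[m, some o, none]) * (ind (Conn[m, some o, some u]) * ind (Conn[m, some o, some k])))).toReal / Z ^ 2 ≤
      L * (A x k * A u o + A o k * A x u) / Z ^ 2 := by
    intro x hx
    refine div_le_div_of_nonneg_right ?_ (pow_nonneg hZpos.le 2)
    have h := afR2_le (G := G) (Λ := Λ) hθ ho hx hu hk
    rw [hLθ, ENNReal.toReal_mul, ENNReal.toReal_mul] at h
    exact h
  refine (sum_le_sum hterm).trans ?_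
  -- the sums of `G♭`
  have hsumk : ∑ x ∈ Λ, A x k / Z ≤ isingCorr G Λ β h .free {k} / (β * h) := by
    have h1 := sum_gAvoid_le_isingCorr_div (G := G) (Λ := Λ) hβ hh hk
    refine le_of_eq_of_le (sum_congr rfl fun x _ => ?_) h1
    simp only [hA]; rw [gAvoidZ_comm]
  have hsumu : ∑ x ∈ Λ, A x u / Z ≤ isingCorr G Λ β h .free {u} / (β * h) := by
    have h1 := sum_gAvoid_le_isingCorr_div (G := G) (Λ := Λ) hβ hh hu
    refine le_of_eq_of_le (sum_congr rfl fun x _ => ?_) h1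
    simp only [hA]; rw [gAvoidZ_comm]
  have hrew : L * (A u o / Z * ∑ x ∈ Λ, A x k / Z + A o k / Z * ∑ x ∈ Λ, A x u / Z) =
      ∑ x ∈ Λ, L * (A x k * A u o + A o k * A x u) / Z ^ 2 := by
    rw [mul_sum, mul_sum, ← sum_add_distrib, mul_sum]
    refine sum_congr rfl fun x _ => ?_
    field_simp
  rw [← hrew]
  refine mul_le_mul_of_nonneg_left (add_le_add ?_ ?_) hL0
  · exact mul_le_mul_of_nonneg_left hsumk (div_nonneg (hA0 u o) hZpos.le)
  · exact mul_le_mul_of_nonneg_left hsumu (div_nonneg (hA0 o k) hZpos.le)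

end R2

end Literature.Probability.LatticeModels
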